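import Summits.NavierStokesRegularity.NavierStokesRegularity.Theses.WeakLambdaEndpoint
import HarnessLib.Audit

/-!
# Birth skeleton (BC3) of the crux `WeakLambdaEndpoint.WeakLambdaCriterion` — line A (energy atom)

(crux item `stmt-NavierStokesRegularity-19625`, rank 2, route `route-NavierStokesRegularity-WeakLambdaEndpoint`;
tree path `Cruxes/WeakLambdaCriterion/Lines/birth.lean`; registrar `planner-skel-stmt-NavierStokesRegularity-19625-0`,
2026-08-17, re-typing the route author's pre-open line-A skeleton (evidence `WeakLambdaCriterion_birth.lean` on the
item, not visible from this seat) against the gate-written route file. `ledger crux ls`: no `Disproof.lean` is filed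
for this crux, so there is no `_false_without_` obstruction to honour yet.)

THE CRUX (X1, the attacked conjunct of the route). There is a threshold `c₀ > 0` such that every classical
Navier–Stokes solution `u` on `ℝ³ × [0,T)` (zero force, pressure `p`) which is Leray–Hopf on `[0,T]` from its
rapidly decaying datum `u 0`, and whose Cheskidov–Shvydkoy dissipation wavenumber `Λ_{c₀}` lies in
weak-`L^{5/2}(0,T)` — `sup_n 2^{5n}·|{t ∈ (0,T) | ∃ j > n, c₀ν2^j ≤ ‖Δ̇_j u(t)‖_∞}|² < ∞` — extends smoothly
past `T`.

THE CUT (line A of the route header: "a weak-L^{5/2} first singularity must carry an energy ATOM, and atoms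
are forbidden"). The intermediate object is the ENERGY ATOM of `u` at `(x₀, T)`:
`∃ η > 0, ∀ r > 0, limsup_{t → T⁻} ∫_{B_r(x₀)} |u(t,x)|² dx ≥ η` (a Dirac component of the Leslie–Shvydkoy
energy measure `E_T = w*-lim_{t→T} |u(t)|² dx`, arXiv:1705.04420 §2), written with the lower Lebesgue
integral (no Bochner junk value) and the left-neighbourhood filter `𝓝[<] T`.

* `stub_atomOfWeakLambda` [XL, OPEN — the load-bearing stub; dissipation-wavenumber + local energy
  inequality]: for SOME `c₀ > 0`, a classical Leray–Hopf solution from rapidly decaying data with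
  `Λ_{c₀} ∈ L^{5/2,∞}(0,T)` that does NOT extend smoothly past `T` has an energy atom at some `x₀` at time
  `T`. Mechanism claimed by the route: weak-`L^{5/2}` makes the saturated cascade SPARSE IN TIME
  (`|{Λ > 2^n}| ≲ 2^{-5n/2}`), the local energy inequality (flux `|u|³ + |p||u|`, spatially local) and a
  CKN / Leslie–Shvydkoy iteration (arXiv:1705.04420 §§3–4, the `A(r,x₀)` bounds) convert time-sparsity of
  the high modes into failure of the upper-density bound at a point, i.e. an atom. Why it might fail: the
  weak endpoint is exactly the rate of Tao's averaged cascade (pulse `≍ N^{-5/2}`, arXiv:1402.0290 p.32),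
  and a Type-II singularity could concentrate on a positive-dimensional set with NO atom while keeping
  `Λ ∈ L^{5/2,∞}` — then the conclusion is false and line A dies (line B, `Lines/bandlimited.lean`, is the
  route's alternative).
* `stub_noEnergyAtom` [L/XL, OPEN beyond Type I — Leslie–Shvydkoy's question]: a classical solution on
  `[0,T)` that is Leray–Hopf from rapidly decaying data has NO energy atom at time `T`: for every `x₀` and
  `η > 0` there is `r > 0` with `∫_{B_r(x₀)} |u(t)|² < η` for all `t < T` close to `T`. Known under Type I in
  time (Leslie–Shvydkoy 2018 Thm 1.2: energy equality at the first blow-up time; Chae–Wolf for Type-I Euler,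
  loc. cit. p.6); for general Leray–Hopf solutions the `L^qL^p` exponents available (`L^∞L² ∩ L²L⁶`) give
  `β ≤ 0` in arXiv:1705.04420 (1.3), so no lower bound on the local dimension of `E_T` is known — the stub is
  open, and it is a consequence of the summit (a smooth extension is bounded near `(x₀,T)`).

`WeakLambdaCriterion_of : Theses.WeakLambdaEndpoint.WeakLambdaCriterion` is the skeleton theorem (A12 shape:
the crux BY NAME, no `Prop` hypotheses, the two stubs used by name). The glue is closed and honest
(`WeakLambdaCriterion_of_hyps`: the stub STATEMENTS as hypotheses, the crux BODY verbatim as conclusion —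
so that `_of` is the only theorem of this file concluding the crux by name): take `c₀` from the atom stub;
given a solution with `Λ_{c₀} ∈ L^{5/2,∞}`, argue by contradiction — if it does not extend, the atom stub
gives `x₀, η` with `∃ᶠ t → T⁻, η ≤ ∫_{B_r(x₀)}|u(t)|²` for every `r`, while the no-atom stub gives an `r`
with `∀ᶠ t → T⁻, ∫_{B_r(x₀)}|u(t)|² < η`; a frequently-and-eventually clash.

BC3 PROBES (registrar's `bc/probe_*.lean`, quoted in `Lines/birth.md` if present and in the registrar's
NOTES.md): for each stub `S`, `S → WeakLambdaCriterion` and `S → NavierStokesRegularity` by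
`first | exact? | simpa | aesop` FAIL — no stub is cheaply the crux or the summit.
-/

noncomputable section

open Set MeasureTheory Filter Topology
open scoped ENNReal NNReal

namespace Summit.NavierStokesRegularity.NavierStokesRegularity.Cruxes.WeakLambdaCriterion.Birth

set_option linter.unusedVariables false
set_option linter.dupNamespace false

/-- **stub 1 — `stub_atomOfWeakLambda` (XL, OPEN; the load-bearing stub of line A).** There is a
threshold `c₀ > 0` such that: if a classical Navier–Stokes solution `u` on `ℝ³ × [0,T)` (zero force), Leray–Hopf
on `[0,T]` from its rapidly decaying datum, has dissipation wavenumber `Λ_{c₀} ∈ L^{5/2,∞}(0,T)` (the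
weak-`L^{5/2}` level-set bound of the crux, verbatim) and does NOT extend smoothly past `T`, then its energy
measure at time `T` has an ATOM: some `x₀` and `η > 0` with `limsup_{t→T⁻} ∫_{B_r(x₀)} |u(t)|² ≥ η` for
every `r > 0`. -/
theorem stub_atomOfWeakLambda :
    ∃ c₀ : ℝ, 0 < c₀ ∧ ∀ (ν T : ℝ), 0 < ν → 0 < T →
      ∀ (u : ℝ → EuclideanSpace ℝ (Fin 3) → EuclideanSpace ℝ (Fin 3)) (p : ℝ → EuclideanSpace ℝ (Fin 3) → ℝ),
        Literature.Analysis.FluidPDE.IsClassicalNSSolutionOn (Set.Ico 0 T) ν 0 u p →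
        Literature.Analysis.FluidPDE.IsLerayHopfOn T ν 0 (u 0) u →
        Literature.Analysis.FluidPDE.HasRapidSpatialDecay (u 0) →
        (∃ A : NNReal, ∀ n : ℕ, (2 : ENNReal) ^ (5 * n) *
          MeasureTheory.volume {t ∈ Set.Ioo 0 T | ∃ j : ℕ, n < j ∧
            ENNReal.ofReal (c₀ * ν) * 2 ^ j ≤
              MeasureTheory.eLpNorm (Literature.Analysis.FunctionSpaces.blockFn (j : ℤ) (u t)) ⊤ MeasureTheory.volume} ^ 2
            ≤ (A : ENNReal)) →
        ¬ Literature.Analysis.FluidPDE.HasSmoothExtensionPast ν 0 u T →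
        ∃ (x₀ : EuclideanSpace ℝ (Fin 3)) (η : NNReal), 0 < η ∧ ∀ r : ℝ, 0 < r →
          ∃ᶠ t in 𝓝[<] T, (η : ENNReal) ≤ ∫⁻ x in Metric.ball x₀ r, ‖u t x‖ₑ ^ 2 := by
  sorry

/-- **stub 2 — `stub_noEnergyAtom` (L/XL, OPEN beyond Type I; Leslie–Shvydkoy's no-concentration question
at dimension zero).** A classical Navier–Stokes solution on `ℝ³ × [0,T)` (zero force) which is Leray–Hopf on
`[0,T]` from its rapidly decaying datum has NO energy atom at time `T`: for every centre `x₀` and every `η > 0`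
there is a radius `r > 0` such that `∫_{B_r(x₀)} |u(t)|² < η` for all `t < T` sufficiently close to `T`.
(Type I in time: Leslie–Shvydkoy 2018, Thm 1.2 / §4; Type-I Euler: Chae–Wolf; open in general.) -/
theorem stub_noEnergyAtom :
    ∀ (ν T : ℝ), 0 < ν → 0 < T →
      ∀ (u : ℝ → EuclideanSpace ℝ (Fin 3) → EuclideanSpace ℝ (Fin 3)) (p : ℝ → EuclideanSpace ℝ (Fin 3) → ℝ),
        Literature.Analysis.FluidPDE.IsClassicalNSSolutionOn (Set.Ico 0 T) ν 0 u p →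
        Literature.Analysis.FluidPDE.IsLerayHopfOn T ν 0 (u 0) u →
        Literature.Analysis.FluidPDE.HasRapidSpatialDecay (u 0) →
        ∀ (x₀ : EuclideanSpace ℝ (Fin 3)) (η : NNReal), 0 < η →
          ∃ r : ℝ, 0 < r ∧ ∀ᶠ t in 𝓝[<] T, ∫⁻ x in Metric.ball x₀ r, ‖u t x‖ₑ ^ 2 < (η : ENNReal) := by
  sorry

/-- **Birth composition, CLOSED form.** The two stub STATEMENTS imply the crux — its body verbatim (the
by-name form is `WeakLambdaCriterion_of` below). Real glue, pure logic over the two stubs: the threshold is the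
atom stub's `c₀`; a non-extending solution would carry an atom at some `x₀` (frequently `η ≤` local energy on
every ball), contradicting the no-atom stub at `x₀, η` (eventually `<` on one ball). -/
theorem WeakLambdaCriterion_of_hyps
    (hA : ∃ c₀ : ℝ, 0 < c₀ ∧ ∀ (ν T : ℝ), 0 < ν → 0 < T →
      ∀ (u : ℝ → EuclideanSpace ℝ (Fin 3) → EuclideanSpace ℝ (Fin 3)) (p : ℝ → EuclideanSpace ℝ (Fin 3) → ℝ),
        Literature.Analysis.FluidPDE.IsClassicalNSSolutionOn (Set.Ico 0 T) ν 0 u p →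
        Literature.Analysis.FluidPDE.IsLerayHopfOn T ν 0 (u 0) u →
        Literature.Analysis.FluidPDE.HasRapidSpatialDecay (u 0) →
        (∃ A : NNReal, ∀ n : ℕ, (2 : ENNReal) ^ (5 * n) *
          MeasureTheory.volume {t ∈ Set.Ioo 0 T | ∃ j : ℕ, n < j ∧
            ENNReal.ofReal (c₀ * ν) * 2 ^ j ≤
              MeasureTheory.eLpNorm (Literature.Analysis.FunctionSpaces.blockFn (j : ℤ) (u t)) ⊤ MeasureTheory.volume} ^ 2
            ≤ (A : ENNReal)) →
        ¬ Literature.Analysis.FluidPDE.HasSmoothExtensionPast ν 0 u T →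
        ∃ (x₀ : EuclideanSpace ℝ (Fin 3)) (η : NNReal), 0 < η ∧ ∀ r : ℝ, 0 < r →
          ∃ᶠ t in 𝓝[<] T, (η : ENNReal) ≤ ∫⁻ x in Metric.ball x₀ r, ‖u t x‖ₑ ^ 2)
    (hN : ∀ (ν T : ℝ), 0 < ν → 0 < T →
      ∀ (u : ℝ → EuclideanSpace ℝ (Fin 3) → EuclideanSpace ℝ (Fin 3)) (p : ℝ → EuclideanSpace ℝ (Fin 3) → ℝ),
        Literature.Analysis.FluidPDE.IsClassicalNSSolutionOn (Set.Ico 0 T) ν 0 u p →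
        Literature.Analysis.FluidPDE.IsLerayHopfOn T ν 0 (u 0) u →
        Literature.Analysis.FluidPDE.HasRapidSpatialDecay (u 0) →
        ∀ (x₀ : EuclideanSpace ℝ (Fin 3)) (η : NNReal), 0 < η →
          ∃ r : ℝ, 0 < r ∧ ∀ᶠ t in 𝓝[<] T, ∫⁻ x in Metric.ball x₀ r, ‖u t x‖ₑ ^ 2 < (η : ENNReal)) :
    ∃ c₀ : ℝ, 0 < c₀ ∧ ∀ (ν T : ℝ), 0 < ν → 0 < T → ∀ (u : ℝ → EuclideanSpace ℝ (Fin 3) → EuclideanSpace ℝ (Fin 3)) (p : ℝ → EuclideanSpace ℝ (Fin 3) → ℝ), Literature.Analysis.FluidPDE.IsClassicalNSSolutionOn (Set.Ico 0 T) ν 0 u p → Literature.Analysis.FluidPDE.IsLerayHopfOn T ν 0 (u 0) u → Literature.Analysis.FluidPDE.HasRapidSpatialDecay (u 0) → (∃ A : NNReal, ∀ n : ℕ, (2 : ENNReal) ^ (5 * n) * MeasureTheory.volume {t ∈ Set.Ioo 0 T | ∃ j : ℕ, n < j ∧ ENNReal.ofReal (c₀ * ν) * 2 ^ j ≤ MeasureTheory.eLpNorm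 (Literature.Analysis.FunctionSpaces.blockFn (j : ℤ) (u t)) ⊤ MeasureTheory.volume} ^ 2 ≤ (A : ENNReal)) → Literature.Analysis.FluidPDE.HasSmoothExtensionPast ν 0 u T := by
  obtain ⟨c₀, hc₀, hatom⟩ := hA
  refine ⟨c₀, hc₀, ?_⟩
  intro ν T hν hT u p hcl hLH hdec hweak
  by_contra hext
  -- the atom of the non-extending solution …
  obtain ⟨x₀, η, hη, hconc⟩ := hatom ν T hν hT u p hcl hLH hdec hweak hext
  -- … against the no-atom stub at the same centre and height
  obtain ⟨r, hr, hsmall⟩ := hN ν T hν hT u p hcl hLH hdec x₀ η hη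
  exact (hconc r hr) (hsmall.mono fun t ht hle => absurd ht (not_lt.mpr hle))

/-- **Birth composition (the skeleton theorem, A12 shape): the crux BY NAME from the two registered stubs,
used by name; all glue is in the closed `WeakLambdaCriterion_of_hyps`.** (Closed modulo the `sorry`s of
`stub_atomOfWeakLambda` and `stub_noEnergyAtom` only.) -/
theorem WeakLambdaCriterion_of : Theses.WeakLambdaEndpoint.WeakLambdaCriterion :=
  WeakLambdaCriterion_of_hyps stub_atomOfWeakLambda stub_noEnergyAtom

end Summit.NavierStokesRegularity.NavierStokesRegularity.Cruxes.WeakLambdaCriterion.Birth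

end
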